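import Summits.QuantumFields.YangMills.Theorems.SmallFieldWideningLargeFieldMassRefinementTailOfHeightTail
import Summits.QuantumFields.YangMills.Theorems.UnitScaleTiltHistoryTailStubBudget
import Summits.QuantumFields.YangMills.Theorems.UnitScaleTiltHistoryTailBoundedHeight
import Summits.QuantumFields.YangMills.Theorems.UnitScaleTiltHistoryTailPerPlaquetteV3b
import Literature.MathematicalPhysics.QuantumFieldTheory.Balaban1983to89.T3ThresholdSmallness

/-!
# Route `SmallFieldWidening` — crux r3 `LargeFieldMassRefinementTail` (stmt-QuantumFields-22884) MODULO THE REGISTERED STUB OF CRUX K2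
# `HistoryTail` (stmt-QuantumFields-18916), VERBATIM (support file, leaf; width seat `ym-line-sfw-p2-w2`, line `birth` v3)

WHY.  Line `birth` of crux r3 is reduced (skeleton v3) to the one stub `stub_avgTailPkg` — the per-family averaged-height large-field tail
package `AvgTailPkg := ∀ L, ∃ (b₀, p₀), ∃ γ₁ ≤ 1, ∀ F (F.L = L) ∀ 0 < γ ≤ γ₁, AveragedTailAt F γ b₀ p₀`, the located, unprinted
renormalisation-group content r3 shares with crux K2 of route `UnitScaleTilt`.  The tree already closes r3 from three K2-side currencies
(`…OfIntCoreRec`: the record-free socket `IntCoreRec`, the THRESHOLD-FORM per-plaquette high tail, the χ-record of 19936's stub).  NOT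
covered so far: the text of the ACTIVE REGISTERED STUB of crux K2 `HistoryTail` itself — `stub_perPlaquetteHighRaw` of birth v4
(`Cruxes/HistoryTail/Lines/birth.lean`, sha16 `2dd95f606719a12c`): print's RAW currency `C·β_{K−j}^A·exp(−¼p(g_{K−j})² + κ·x(g_{K−j})^{2+3r₀})`
at the high heights `j > j₀(F, γ)`, collar exponents `(r₀, κ)` exposed with `p₀ > 1 + 3r₀/2`, ONE profile per block size (no thresholds
`(b₁, p₁)`, so the threshold-form closer does not apply to it).

THIS FILE: `averagedTailPkg_of_perPlaquetteHighRaw` — that raw text ⇒ `AvgTailPkg`, by K2's own v4 composition stopped before the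
`HistoryTailAt` step: the LANDED `HistoryTailBirthV4.stub_budget` (p442213; collar cost absorbed into `exp(−c·p²)`), the LANDED
`HistoryTailBoundedHeight.perPlaquette_of_split` (p438760; the bounded heights `j ≤ j₀` are a theorem) and the LANDED
`HistoryTailBirthV3b.stub_tailOfPerPlaquette` (p432346; union bound and profile); block sizes no `T3Family` has are vacuous.  Then
`largeFieldMassRefinementTail_of_perPlaquetteHighRaw` — r3 BY NAME (w2's level-shift bridge `largeFieldMassRefinementTail_of_averagedTail`,
p579220).  Consequence for the lead: the hour 18916's registered stub lands by name, r3 closes by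
`exact largeFieldMassRefinementTail_of_perPlaquetteHighRaw stub_perPlaquetteHighRaw`.

WHAT THIS IS NOT: no large-field estimate is proved — `stub_perPlaquetteHighRaw` is OPEN (XXL; [Balaban1985UV3] (41) p.266, (47) p.267,
(71) p.273 print the per-plaquette factor inside the densities, not the Gibbs-probability bound); nothing here bears on the Yang–Mills mass
gap (the line serves the record rung R3 only).

References: T. Bałaban, CMP 102 (1985) 255–275 [Balaban1985UV3]; C. King, CMP 102 (1986) 649–677 [King1986].
-/

noncomputable section

open MeasureTheory Filter Topology
open Literature.MathematicalPhysics.QuantumFieldTheory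
open Literature.MathematicalPhysics.QuantumFieldTheory.Balaban1983to89
open Literature.MathematicalPhysics.QuantumFieldTheory.Balaban1983to89.T3ContinuumYM3Torus
open Literature.MathematicalPhysics.QuantumFieldTheory.Balaban1983to89.T3UnitScaleTilt
open Literature.MathematicalPhysics.QuantumFieldTheory.Balaban1983to89.T3UnitLawDensityEML
open Literature.MathematicalPhysics.QuantumFieldTheory.Balaban1983to89.T3CruxEstimates
open Literature.MathematicalPhysics.QuantumFieldTheory.Balaban1983to89.T3BareTailProfile
open Literature.MathematicalPhysics.QuantumFieldTheory.Balaban1983to89.T3Thresholds (coupling_le_one)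
open Literature.MathematicalPhysics.QuantumFieldTheory.Balaban1983to89.T3ThresholdSmallness (sqrt_coupling_pos_le)
open Summit.QuantumFields.YangMills.Theorems
open Summit.QuantumFields.YangMills.Theorems.LargeFieldMassRefinementTailOfHeightTail (largeFieldMassRefinementTail_of_averagedTail)

namespace Summit.QuantumFields.YangMills.Theorems.LargeFieldMassRefinementTailOfHistoryTailStub

/-- **`AvgTailPkg ⇐ THE TEXT OF K2's REGISTERED STUB `stub_perPlaquetteHighRaw`** (birth v4 of crux `HistoryTail`, stmt-QuantumFields-18916):
if for every odd block size `L > 1` there are collar exponents `r₀, κ ≥ 0`, a Bałaban profile `(b₀, p₀)` with `b₀ > 0`, `2 < p₀`,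
`1 + 3r₀/2 < p₀` and a coupling threshold `0 < γ₁ ≤ 1` such that every family with `F.L = L` and every `0 < γ ≤ γ₁` admit a height `j₀` and
constants `C ≥ 0`, `A` with `Gibbs_K{θ(K−j) ≤ |Ū^{j}(∂p) − 1|} ≤ C·β_{K−j}^A·exp(−¼p(g_{K−j})² + κ·(1 + log g_{K−j}⁻¹)^{2+3r₀})` for all
`K`, all `j₀ < j ≤ K` and all plaquettes `p` of `T^{(j)}_K`, then for EVERY `L` there are `b₀ > 0`, `p₀ > 2`, `0 < γ₁ ≤ 1` with
`AveragedTailAt F γ b₀ p₀` for every family with `F.L = L` and every `0 < γ ≤ γ₁` (collar budget `stub_budget`, bounded heights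
`perPlaquette_of_split`, union bound `stub_tailOfPerPlaquette` — all landed theorems of the K2 programme).
[cite: Balaban1985UV3, (7) p.257, (41) p.266, (47) p.267 and (71) p.273] -/
theorem averagedTailPkg_of_perPlaquetteHighRaw
    (hraw : ∀ (L : ℕ), Odd L → 1 < L →
      ∃ r₀ κ b₀ p₀ γ₁ : ℝ, 0 ≤ r₀ ∧ 0 ≤ κ ∧ 0 < b₀ ∧ 2 < p₀ ∧ 1 + 3 * r₀ / 2 < p₀ ∧ 0 < γ₁ ∧ γ₁ ≤ 1 ∧
        ∀ (F : T3Family) (γ : ℝ), F.L = L → 0 < γ → γ ≤ γ₁ →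
          ∃ (j₀ : ℕ) (C : ℝ) (A : ℕ), 0 ≤ C ∧
            ∀ (K j : ℕ), j₀ < j → j ≤ K → ∀ p : Plaq (F.P K) j,
              (gibbsK F ℰp γ K).real
                  {U | θBal F.L γ b₀ p₀ (K - j) ≤
                    GaugeGroup.dist1 (GaugeField.plaqHol
                      (Averaging.iter (fun _ => BlockAveraging.blockAvg ℰp) j U) p)} ≤
                C * (F.scheme ℰp γ).β (K - j) ^ A *
                  Real.exp (-(B10.pFun b₀ p₀ (Real.sqrt (γ * ((F.L : ℝ)⁻¹) ^ (K - j))) ^ 2 / 4) +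
                    κ * (1 + Real.log (Real.sqrt (γ * ((F.L : ℝ)⁻¹) ^ (K - j)))⁻¹) ^ (2 + 3 * r₀))) :
    ∀ L : ℕ, ∃ b₀ p₀ γ₁ : ℝ, 0 < b₀ ∧ 2 < p₀ ∧ 0 < γ₁ ∧ γ₁ ≤ 1 ∧
      ∀ (F : T3Family) (γ : ℝ), F.L = L → 0 < γ → γ ≤ γ₁ → AveragedTailAt F γ b₀ p₀ := by
  intro L
  by_cases hL : Odd L ∧ 1 < L
  · obtain ⟨r₀, κ, b₀, p₀, γ₁, hr₀, hκ, hb, hp2, hp, hγ₁, hγ₁1, h⟩ := hraw L hL.1 hL.2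
    obtain ⟨C₆, c, hC₆, hc, hbud⟩ := HistoryTailBirthV4.stub_budget b₀ p₀ r₀ κ hb hr₀ hκ hp
    refine ⟨b₀, p₀, γ₁, hb, hp2, hγ₁, hγ₁1, fun F γ hFL hγ hle => ?_⟩
    have hγ1 : γ ≤ 1 := hle.trans hγ₁1
    have hp01 : (1 : ℝ) ≤ p₀ := by linarith
    have hL1 : 1 ≤ F.L := F.hL.2.le
    obtain ⟨j₀, C, A, hC, hhigh⟩ := h F γ hFL hγ hle
    have hhigh' : ∃ (C : ℝ) (A : ℕ) (c : ℝ), 0 ≤ C ∧ 0 < c ∧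
        ∀ (K j : ℕ), j₀ < j → j ≤ K → ∀ p : Plaq (F.P K) j,
          (gibbsK F ℰp γ K).real
              {U | θBal F.L γ b₀ p₀ (K - j) ≤
                GaugeGroup.dist1 (GaugeField.plaqHol
                  (Averaging.iter (fun _ => BlockAveraging.blockAvg ℰp) j U) p)} ≤
            C * (F.scheme ℰp γ).β (K - j) ^ A *
              Real.exp (-(c * B10.pFun b₀ p₀ (Real.sqrt (γ * ((F.L : ℝ)⁻¹) ^ (K - j))) ^ 2)) := by
      refine ⟨C * C₆, A, c, mul_nonneg hC hC₆, hc, fun K j hj hjK p => ?_⟩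
      have hg := sqrt_coupling_pos_le hL1 hγ (K - j)
      have hg1 := coupling_le_one hL1 hγ hγ1 (K - j)
      have hβA : 0 ≤ C * (F.scheme ℰp γ).β (K - j) ^ A :=
        mul_nonneg hC (pow_nonneg (F.scheme_β_nonneg ℰp hγ.le (K - j)) A)
      calc (gibbsK F ℰp γ K).real
              {U | θBal F.L γ b₀ p₀ (K - j) ≤
                GaugeGroup.dist1 (GaugeField.plaqHol
                  (Averaging.iter (fun _ => BlockAveraging.blockAvg ℰp) j U) p)}
            ≤ C * (F.scheme ℰp γ).β (K - j) ^ A *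
                Real.exp (-(B10.pFun b₀ p₀ (Real.sqrt (γ * ((F.L : ℝ)⁻¹) ^ (K - j))) ^ 2 / 4) +
                  κ * (1 + Real.log (Real.sqrt (γ * ((F.L : ℝ)⁻¹) ^ (K - j)))⁻¹) ^ (2 + 3 * r₀)) := hhigh K j hj hjK p
        _ ≤ C * (F.scheme ℰp γ).β (K - j) ^ A *
                (C₆ * Real.exp (-(c * B10.pFun b₀ p₀ (Real.sqrt (γ * ((F.L : ℝ)⁻¹) ^ (K - j))) ^ 2))) :=
              mul_le_mul_of_nonneg_left (hbud _ hg.1 hg1) hβA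
        _ = C * C₆ * (F.scheme ℰp γ).β (K - j) ^ A *
                Real.exp (-(c * B10.pFun b₀ p₀ (Real.sqrt (γ * ((F.L : ℝ)⁻¹) ^ (K - j))) ^ 2)) := by ring
    have hPP := HistoryTailBoundedHeight.perPlaquette_of_split j₀ F hγ hγ1 hb.le p₀ hhigh'
    exact HistoryTailBirthV3b.stub_tailOfPerPlaquette F γ b₀ p₀ hγ hγ1 hb hp01 hPP
  · refine ⟨1, 3, 1, one_pos, by norm_num, one_pos, le_rfl, fun F γ hFL _ _ => ?_⟩
    have hF := F.hL
    rw [hFL] at hF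
    exact (hL hF).elim

/-- **r3 ⇐ THE TEXT OF K2's REGISTERED STUB `stub_perPlaquetteHighRaw`** (crux `HistoryTail`, stmt-QuantumFields-18916, birth v4): the raw
per-plaquette high tail at every odd block size `L > 1` gives `LargeFieldMassRefinementTail` — the averaged-height package above, then the
level-shift bridge `largeFieldMassRefinementTail_of_averagedTail` (run `K` of `F.refine n` at `γL^{-n}` is run `n + K` of `F` with `n` free
top steps).  The closer for the lead the hour that stub lands: `exact largeFieldMassRefinementTail_of_perPlaquetteHighRaw stub_perPlaquetteHighRaw`.
[cite: Balaban1985UV3, (7) p.257 and (71) p.273] -/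
theorem largeFieldMassRefinementTail_of_perPlaquetteHighRaw
    (hraw : ∀ (L : ℕ), Odd L → 1 < L →
      ∃ r₀ κ b₀ p₀ γ₁ : ℝ, 0 ≤ r₀ ∧ 0 ≤ κ ∧ 0 < b₀ ∧ 2 < p₀ ∧ 1 + 3 * r₀ / 2 < p₀ ∧ 0 < γ₁ ∧ γ₁ ≤ 1 ∧
        ∀ (F : T3Family) (γ : ℝ), F.L = L → 0 < γ → γ ≤ γ₁ →
          ∃ (j₀ : ℕ) (C : ℝ) (A : ℕ), 0 ≤ C ∧
            ∀ (K j : ℕ), j₀ < j → j ≤ K → ∀ p : Plaq (F.P K) j,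
              (gibbsK F ℰp γ K).real
                  {U | θBal F.L γ b₀ p₀ (K - j) ≤
                    GaugeGroup.dist1 (GaugeField.plaqHol
                      (Averaging.iter (fun _ => BlockAveraging.blockAvg ℰp) j U) p)} ≤
                C * (F.scheme ℰp γ).β (K - j) ^ A *
                  Real.exp (-(B10.pFun b₀ p₀ (Real.sqrt (γ * ((F.L : ℝ)⁻¹) ^ (K - j))) ^ 2 / 4) +
                    κ * (1 + Real.log (Real.sqrt (γ * ((F.L : ℝ)⁻¹) ^ (K - j)))⁻¹) ^ (2 + 3 * r₀))) :
    Summit.QuantumFields.YangMills.Theses.SmallFieldWidening.LargeFieldMassRefinementTail :=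
  largeFieldMassRefinementTail_of_averagedTail (averagedTailPkg_of_perPlaquetteHighRaw hraw)

end Summit.QuantumFields.YangMills.Theorems.LargeFieldMassRefinementTailOfHistoryTailStub

end
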